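import Literature.NumberTheory.EllipticCurves.ZpExtensionAnticyclotomicProofs
import Literature.NumberTheory.EllipticCurves.ZpExtensionGlobalReciprocityProofs
import Literature.NumberTheory.GaloisRepresentations.IdelicCharacterProofs
import HarnessLib

/-!
# The `ℤ_p`-rank of a number field of unit rank zero, from the global reciprocity law (proofs)

Topic `NumberTheory/EllipticCurves` (Iwasawa theory of `ℤ_p`-extensions); namespace
`Literature.NumberTheory.EllipticCurves.ZpExtension`.  No new definitions.

This file discharges the named fact `Literature.ZpExtension.zpRank_eq_nrComplexPlaces_add_one K p`
(`ZpExtensionRank.lean`: for a number field `K` of unit rank `0`, `Gal(K̃/K) ≃ ℤ_p^{r₂+1}` in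
choice-free form — Washington, *Introduction to Cyclotomic Fields*, Thm. 13.4; Lang,
*Cyclotomic Fields I and II*, Ch. 5 §5 Thm. 5.2) from the **global reciprocity law** in the
existential form of the named fact `Literature.exists_isGlobalReciprocityMap K`
(`GlobalReciprocity.lean`):

`zpRank_eq_nrComplexPlaces_add_one_of_globalReciprocity :
  exists_isGlobalReciprocityMap K → zpRank_eq_nrComplexPlaces_add_one K p`.

Everything between is proved, following Washington's proof of Thm. 13.4 (p. 265–266):

* lower bound (`r₂ + 1 = [K:ℚ]` jointly surjective characters): local characters of `𝒪_vˣ`,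
  `v ∣ p`, of total number `∑_{v∣p} [K_v:ℚ_p] = [K:ℚ]` (`LocalOneUnitsNumberFieldProofs`), made
  into idele class characters (`ZpExtensionIdelicProofs`, class number + finite unit group),
  transported to `Γ_K` along the reciprocity map (`ZpExtensionGlobalReciprocityProofs`) and
  re-based (`ZpExtensionLatticeProofs`);
* upper bound (every continuous `f : Γ_K → ℤ_p` is a `ℤ_p`-combination of those): `f` factors
  through `Γ_K^ab`, is pulled back to `C_K` along `θ`; a `ℤ_p`-valued idele class character is
  determined on `∏_{v∣p} 𝒪_vˣ` (`IdelicCharacterProofs`, `Literature.NumberTheory.GaloisRepresentations.IdelicCharacter.eq_one_of_forall_localUnits`: archimedean ideles and `𝒪_vˣ`, `v ∤ p`,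
  are killed; congruence subgroups; class number), and `Hom_cont(𝒪_vˣ, ℤ_p)` has rank
  `[K_v : ℚ_p]` (`LocalOneUnitsProofs.exists_forall_pow_mul_eq_sum`); a multiple of `f` is thus a
  combination of the constructed characters, and joint surjectivity makes the combination
  integral.

For `K` of unit rank `0`, `[K:ℚ] = r₂ + 1` (`r₁ + r₂ = 1`; cf. `finrank_eq_nrComplexPlaces_add_one` in
`ZpExtensionRankCFTProofs.lean`), which is why
no Leopoldt defect appears.  Corollary (`exists_isAnticyclotomic_of_globalReciprocity`): the
anticyclotomic `ℤ_p`-extension of an imaginary quadratic field exists given the reciprocity law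
for `ℚ` and for `K` (via `exists_isAnticyclotomic_of_zpRank_facts`), with no Kronecker–Weber
input.

## References

* L. C. Washington, *Introduction to Cyclotomic Fields*, 2nd ed., GTM 83, §13.1, Thm. 13.4.
* S. Lang, *Cyclotomic Fields I and II*, GTM 121, Ch. 5 §5, Thm. 5.1–5.2.
* J. Neukirch, *Class Field Theory — The Bonn Lectures* (2013), Part III (7.12).
-/

noncomputable section

open NumberField NumberField.InfinitePlace IsDedekindDomain Field Topology

namespace Literature.NumberTheory.EllipticCurves

namespace ZpExtension

universe u

variable {K : Type u} [Field K] [NumberField K] {p : ℕ} [Fact p.Prime]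

omit [NumberField K] in
/-- A continuous character `Γ_K →ₜ* ℤ_p` factors continuously through the topological
abelianisation `Γ_K → Γ_K^ab` (its kernel is closed and contains the commutators).
[folklore] -/
theorem exists_continuousMonoidHom_abelianization (f : absoluteGaloisGroup K →ₜ* Multiplicative ℤ_[p]) :
    ∃ fab : absoluteGaloisGroupAbelianization K →ₜ* Multiplicative ℤ_[p],
      ∀ σ, fab (QuotientGroup.mk' (commutator (absoluteGaloisGroup K)).topologicalClosure σ) = f σ := by
  have hle : (commutator (absoluteGaloisGroup K)).topologicalClosure ≤ f.toMonoidHom.ker :=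
    Subgroup.topologicalClosure_minimal _ (Abelianization.commutator_subset_ker f.toMonoidHom)
      ((isClosed_singleton (x := (1 : Multiplicative ℤ_[p]))).preimage f.continuous)
  let g : absoluteGaloisGroupAbelianization K →* Multiplicative ℤ_[p] :=
    QuotientGroup.lift _ f.toMonoidHom hle
  have hg : Continuous g := (QuotientGroup.isQuotientMap_mk _).continuous_iff.2 f.continuous
  exact ⟨⟨g, hg⟩, fun σ => rfl⟩

/-- **The `ℤ_p`-rank of a number field of unit rank zero, from the reciprocity law.**  For a
number field `K` with `NumberField.Units.rank K = 0` (`K = ℚ` or imaginary quadratic), the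
global reciprocity law (`exists_isGlobalReciprocityMap K`) implies
`zpRank_eq_nrComplexPlaces_add_one K p`: there are `r₂ + 1 = [K:ℚ]` continuous characters
`Φᵢ : Γ_K →ₜ* ℤ_p`, jointly surjective, of which every continuous character is a
`ℤ_p`-combination — i.e. `Gal(K̃/K) ≃ ℤ_p^{r₂+1}` (Washington, Thm. 13.4 with `δ = 0`; Lang,
Thm. 5.2).  See the module docstring for the architecture of the proof.
Ref: Washington, *Introduction to Cyclotomic Fields*, §13.1, Thm. 13.4 (p. 265–266); Lang,
*Cyclotomic Fields I and II*, Ch. 5 §5, Thm. 5.1–5.2; Neukirch, *Class Field Theory — The Bonn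
Lectures*, III (7.12). [folklore] -/
theorem zpRank_eq_nrComplexPlaces_add_one_of_globalReciprocity (hGR : GaloisRepresentations.exists_isGlobalReciprocityMap K) :
    zpRank_eq_nrComplexPlaces_add_one K p := by
  classical
  intro h0
  obtain ⟨θ, hθ⟩ := hGR
  have hp : p.Prime := Fact.out
  have hunits := isOfFinOrder_units_of_rank_eq_zero (K := K) h0
  set d : ℕ := Module.finrank ℚ K with hd_def
  -- `[K:ℚ] = r₂ + 1` for unit rank `0` (`r₁ + r₂ = 1`); cf.
  -- `Literature.NumberTheory.EllipticCurves.ZpExtension.finrank_eq_nrComplexPlaces_add_one` (`ZpExtensionRankCFTProofs.lean`).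
  have hd : d = nrComplexPlaces K + 1 := by
    have h1 : Fintype.card (InfinitePlace K) = nrRealPlaces K + nrComplexPlaces K :=
      card_eq_nrRealPlaces_add_nrComplexPlaces K
    have h2 := card_add_two_mul_card_eq_rank (K := K)
    have h3 : 0 < Fintype.card (InfinitePlace K) := Fintype.card_pos
    rw [NumberField.Units.rank] at h0
    omega
  /- Step 1: the places above `p` and the local characters (with card, surjectivity, rank). -/
  have hp0 : (p : 𝓞 K) ≠ 0 := by exact_mod_cast hp.ne_zero
  have hI : Ideal.span {(p : 𝓞 K)} ≠ 0 := by
    rw [Ne, Ideal.zero_eq_bot, Ideal.span_singleton_eq_bot]; exact hp0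
  set T : Finset (HeightOneSpectrum (𝓞 K)) := (Ideal.finite_factors hI).toFinset with hT_def
  have hmemT : ∀ w : HeightOneSpectrum (𝓞 K), w ∈ T ↔ (p : 𝓞 K) ∈ w.asIdeal := fun w => by
    rw [hT_def, Set.Finite.mem_toFinset, Set.mem_setOf_eq, Ideal.dvd_span_singleton]
  choose n N φ hcardloc hsurjloc hrankloc using fun w : T =>
    GaloisRepresentations.OneUnits.exists_continuousMonoidHom_adicCompletionIntegers_rank K w.1 p ((hmemT w.1).1 w.2)
  let n' : HeightOneSpectrum (𝓞 K) → ℕ := fun w => if hw : w ∈ T then n ⟨w, hw⟩ else 0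
  have hsum : ∑ w ∈ T, n' w = d :=
    GaloisRepresentations.OneUnits.sum_eq_finrank K p T (fun w hw => (hmemT w).2 hw) n' fun w hw => by
      simp only [n', dif_pos hw]; exact hcardloc ⟨w, hw⟩
  let J := Σ w : T, Fin (n w)
  have hcardJ : Fintype.card J = d := by
    rw [Fintype.card_sigma, ← hsum, ← Finset.sum_coe_sort T]
    refine Finset.sum_congr rfl fun w _ => ?_
    rw [Fintype.card_fin]; simp only [n', dif_pos w.2]
  let e : J ≃ Fin d := Fintype.equivOfCardEq (by rw [hcardJ, Fintype.card_fin])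
  /- Step 2: idelic characters and their transport to `Γ_K`. -/
  obtain ⟨h, χ, hh0, hprinc, hunit⟩ :=
    exists_idelicCharacters_of_localCharacters (K := K) p hunits T n φ
  obtain ⟨κ, hκ⟩ := exists_characters_of_idelicCharacters (p := p) hθ χ hprinc
  -- notation for `Γ_K → Γ_K^ab`
  let π : absoluteGaloisGroup K →* absoluteGaloisGroupAbelianization K :=
    QuotientGroup.mk' (commutator (absoluteGaloisGroup K)).topologicalClosure
  have hπθ : ∀ σ : absoluteGaloisGroup K, ∃ x : GaloisRepresentations.ideleGroup K,
      π σ = θ (x : GaloisRepresentations.ideleGroup K ⧸ GaloisRepresentations.principalIdeles K) := fun σ => by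
    obtain ⟨c, hc⟩ := hθ.surjective (π σ)
    obtain ⟨x, rfl⟩ := QuotientGroup.mk_surjective c
    exact ⟨x, hc.symm⟩
  have hθπ : ∀ x : GaloisRepresentations.ideleGroup K, ∃ σ : absoluteGaloisGroup K,
      π σ = θ (x : GaloisRepresentations.ideleGroup K ⧸ GaloisRepresentations.principalIdeles K) := fun x =>
    QuotientGroup.mk'_surjective _ _
  /- Step 3: joint image of `κ` contains `p^M ℤ_p^J`, `M = a + ∑ N_w`, `h = p^a · unit`. -/
  have hhp : (h : ℤ_[p]) ≠ 0 := by exact_mod_cast hh0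
  set a : ℕ := (h : ℤ_[p]).valuation with ha_def
  set η : ℤ_[p]ˣ := PadicInt.unitCoeff hhp with hη_def
  have hh_eq : (h : ℤ_[p]) = η * (p : ℤ_[p]) ^ a := PadicInt.unitCoeff_spec hhp
  set Nmax : ℕ := ∑ w : T, N w with hNmax_def
  have hNle : ∀ w : T, N w ≤ Nmax := fun w =>
    Finset.single_le_sum (f := N) (fun _ _ => Nat.zero_le _) (Finset.mem_univ w)
  have hsurjκ : ∀ Y : J → ℤ_[p], ∃ σ : absoluteGaloisGroup K, ∀ j,
      (κ j σ).toAdd = (p : ℤ_[p]) ^ (a + Nmax) * Y j := by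
    intro Y
    have hz : ∀ w : T, ∃ u : (w.1.adicCompletionIntegers K)ˣ, ∀ i,
        (φ w i u).toAdd = (p : ℤ_[p]) ^ N w *
          (((η⁻¹ : ℤ_[p]ˣ) : ℤ_[p]) * (p : ℤ_[p]) ^ (Nmax - N w) * Y ⟨w, i⟩) :=
      fun w => hsurjloc w _
    choose u hu using hz
    obtain ⟨x₀, hx₀_mem, hx₀_loc, -, -⟩ := exists_mem_unitIdeles_localUnit_eq (K := K) T u
    obtain ⟨σ, hσ⟩ := hθπ x₀
    refine ⟨σ, fun j => ?_⟩
    rw [hκ j σ x₀ hσ, hunit j x₀ hx₀_mem, hx₀_loc, hu, hh_eq]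
    obtain ⟨dd, hdd⟩ := Nat.exists_eq_add_of_le (hNle j.1)
    rw [hdd, Nat.add_sub_cancel_left, pow_add, pow_add]
    have hηη : ((η : ℤ_[p]ˣ) : ℤ_[p]) * ((η⁻¹ : ℤ_[p]ˣ) : ℤ_[p]) = 1 := Units.mul_inv η
    linear_combination ((p : ℤ_[p]) ^ a * (p : ℤ_[p]) ^ N j.1 * (p : ℤ_[p]) ^ dd * Y j) * hηη
  /- Step 4: re-base (indexing by `Fin d`). -/
  let κF : Fin d → (absoluteGaloisGroup K →ₜ* Multiplicative ℤ_[p]) := fun i => κ (e.symm i)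
  have hsurjκF : ∀ y : Fin d → ℤ_[p], ∃ σ : absoluteGaloisGroup K, ∀ i,
      (κF i σ).toAdd = (p : ℤ_[p]) ^ (a + Nmax) * y i := fun y => by
    obtain ⟨σ, hσ⟩ := hsurjκ (y ∘ e)
    exact ⟨σ, fun i => by rw [show κF i = κ (e.symm i) from rfl, hσ, Function.comp_apply,
      Equiv.apply_symm_apply]⟩
  obtain ⟨κ', hκ'surj, hκ'rel⟩ := exists_surjective_and_forall_eq_sum κF (a + Nmax) hsurjκF
  choose cc hcc using hκ'rel
  /- Step 5: spanning. -/
  have hspan : ∀ f : absoluteGaloisGroup K →ₜ* Multiplicative ℤ_[p],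
      ∃ b : Fin d → ℤ_[p], ∀ σ, (f σ).toAdd = ∑ l, b l * (κ' l σ).toAdd := by
    intro f
    -- (i) factor through `Γ_K^ab`, pull back to `𝕀_K`
    obtain ⟨fab, hfab⟩ := exists_continuousMonoidHom_abelianization f
    let Gf : GaloisRepresentations.ideleGroup K →ₜ* Multiplicative ℤ_[p] :=
      fab.comp ⟨θ.comp (QuotientGroup.mk' (GaloisRepresentations.principalIdeles K)),
        hθ.continuous.comp QuotientGroup.continuous_mk⟩
    have hGf_apply : ∀ x, Gf x = fab (θ (x : GaloisRepresentations.ideleGroup K ⧸ GaloisRepresentations.principalIdeles K)) := fun x => rfl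
    have hGf_princ : ∀ x ∈ GaloisRepresentations.principalIdeles K, Gf x = 1 := fun x hx => by
      rw [hGf_apply, (QuotientGroup.eq_one_iff x).2 hx, map_one, map_one]
    -- (ii) local expansions at `w ∣ p`
    have hloc_exp : ∀ w : T, ∃ c : Fin (n w) → ℤ_[p], ∀ uu : (w.1.adicCompletionIntegers K)ˣ,
        (p : ℤ_[p]) ^ N w * (Gf (GaloisRepresentations.localUnits w.1 (Units.map
          ((w.1.adicCompletionIntegers K).subtype : _ →* _) uu))).toAdd =
          ∑ i, c i * (φ w i uu).toAdd := fun w => by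
      let ψ : (w.1.adicCompletionIntegers K)ˣ →ₜ* Multiplicative ℤ_[p] :=
        { toFun := fun uu => Gf (GaloisRepresentations.localUnits w.1 (Units.map
            ((w.1.adicCompletionIntegers K).subtype : _ →* _) uu))
          map_one' := by rw [map_one, map_one, map_one]
          map_mul' := fun x y => by rw [map_mul, map_mul, map_mul]
          continuous_toFun := Gf.continuous.comp (GaloisRepresentations.IdelicCharacter.continuous_localUnits_unitsMap w.1) }
      exact hrankloc w ψ
    choose c hc using hloc_exp
    -- (iii) the difference character `D = C · Gf - ∑ c'_j χ_j`, `C = h p^{Nmax}`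
    let c' : J → ℤ_[p] := fun j => (p : ℤ_[p]) ^ (Nmax - N j.1) * c j.1 j.2
    let Dfun : GaloisRepresentations.ideleGroup K → ℤ_[p] := fun x =>
      (h : ℤ_[p]) * (p : ℤ_[p]) ^ Nmax * (Gf x).toAdd - ∑ j, c' j * (χ j x).toAdd
    have hD_mul : ∀ x y, Dfun (x * y) = Dfun x + Dfun y := fun x y => by
      simp only [Dfun, map_mul, toAdd_mul, mul_add, Finset.sum_add_distrib]; ring
    have hD_cont : Continuous Dfun :=
      ((continuous_const.mul (continuous_toAdd.comp Gf.continuous)).sub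
        (continuous_finsetSum _ fun j _ => continuous_const.mul
          (continuous_toAdd.comp (χ j).continuous)))
    let D : GaloisRepresentations.ideleGroup K →ₜ* Multiplicative ℤ_[p] :=
      { toFun := fun x => Multiplicative.ofAdd (Dfun x)
        map_one' := by
          have h1 := hD_mul 1 1
          rw [mul_one, left_eq_add] at h1
          rw [h1]; rfl
        map_mul' := fun x y => by rw [hD_mul, ofAdd_add]
        continuous_toFun := continuous_ofAdd.comp hD_cont }
    have hD_apply : ∀ x, (D x).toAdd = Dfun x := fun x => rfl
    have hD_princ : ∀ x ∈ GaloisRepresentations.principalIdeles K, D x = 1 := fun x hx => by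
      apply Multiplicative.toAdd.injective
      rw [hD_apply, toAdd_one]
      change (h : ℤ_[p]) * (p : ℤ_[p]) ^ Nmax * (Gf x).toAdd - ∑ j, c' j * (χ j x).toAdd = 0
      rw [hGf_princ x hx, toAdd_one, mul_zero, zero_sub, neg_eq_zero]
      exact Finset.sum_eq_zero fun j _ => by rw [hprinc j x hx, toAdd_one, mul_zero]
    have hD_loc : ∀ v : HeightOneSpectrum (𝓞 K), (p : 𝓞 K) ∈ v.asIdeal →
        ∀ uu : (v.adicCompletionIntegers K)ˣ,
          D (GaloisRepresentations.localUnits v (Units.map ((v.adicCompletionIntegers K).subtype : _ →* _) uu)) = 1 := by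
      intro v hv uu
      set w₀ : T := ⟨v, (hmemT v).2 hv⟩ with hw₀
      set x : GaloisRepresentations.ideleGroup K := GaloisRepresentations.localUnits v (Units.map ((v.adicCompletionIntegers K).subtype : _ →* _) uu)
        with hx_def
      have hx : x ∈ GaloisRepresentations.unitIdeles K := GaloisRepresentations.IdelicCharacter.localUnits_unitsMap_mem_unitIdeles v uu
      -- local units of `x`
      have hxloc : ∀ w : T, GaloisRepresentations.unitIdeles.localUnit w.1 ⟨x, hx⟩ = if hw : w = w₀ then hw ▸ uu else 1 := by
        intro w
        by_cases hw : w = w₀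
        · subst hw
          rw [dif_pos rfl]
          exact Units.ext (Subtype.ext (by
            rw [GaloisRepresentations.unitIdeles.coe_localUnit]; exact GaloisRepresentations.localUnits_snd_apply_self v _))
        · rw [dif_neg hw]
          have hne : w.1 ≠ v := fun h' => hw (Subtype.ext h')
          exact Units.ext (Subtype.ext (by
            rw [GaloisRepresentations.unitIdeles.coe_localUnit]; exact GaloisRepresentations.localUnits_snd_apply_of_ne _ hne))
      apply Multiplicative.toAdd.injective
      rw [hD_apply, toAdd_one]
      change (h : ℤ_[p]) * (p : ℤ_[p]) ^ Nmax * (Gf x).toAdd - ∑ j, c' j * (χ j x).toAdd = 0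
      -- `∑_j c'_j χ_j(x) = h · ∑_i c'_{w₀,i} φ_{w₀,i}(uu)`
      have hsumχ : ∑ j, c' j * (χ j x).toAdd =
          (h : ℤ_[p]) * ((p : ℤ_[p]) ^ (Nmax - N w₀) * ∑ i, c w₀ i * (φ w₀ i uu).toAdd) := by
        have h1 : ∀ j : J, c' j * (χ j x).toAdd =
            (h : ℤ_[p]) * (c' j * (φ j.1 j.2 (GaloisRepresentations.unitIdeles.localUnit j.1.1 ⟨x, hx⟩)).toAdd) := fun j => by
          rw [hunit j x hx]; ring
        simp_rw [h1]
        rw [← Finset.mul_sum]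
        congr 1
        -- sum over the sigma type: only `w₀` contributes
        rw [Finset.mul_sum, Fintype.sum_sigma, Finset.sum_eq_single w₀]
        · refine Finset.sum_congr rfl fun i _ => ?_
          rw [hxloc, dif_pos rfl]; change (p : ℤ_[p]) ^ (Nmax - N w₀) * c w₀ i * _ = _; ring
        · intro w _ hw
          exact Finset.sum_eq_zero fun i _ => by
            rw [hxloc, dif_neg hw, map_one, toAdd_one, mul_zero]
        · intro h'; exact absurd (Finset.mem_univ w₀) h'
      rw [hsumχ, ← hc w₀ uu, ← hx_def]
      obtain ⟨dd, hdd⟩ := Nat.exists_eq_add_of_le (hNle w₀)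
      rw [hdd, Nat.add_sub_cancel_left, pow_add]
      ring
    have hD1 : D = 1 := GaloisRepresentations.IdelicCharacter.eq_one_of_forall_localUnits p D hD_princ hD_loc
    -- (iv) hence `C · Gf = ∑ c'_j χ_j` on `𝕀_K`, and `C · f = ∑ c'_j κ_j` on `Γ_K`
    have hC : ∀ σ : absoluteGaloisGroup K,
        (h : ℤ_[p]) * (p : ℤ_[p]) ^ Nmax * (f σ).toAdd = ∑ j, c' j * (κ j σ).toAdd := by
      intro σ
      obtain ⟨x, hx⟩ := hπθ σ
      have h1 : (D x).toAdd = 0 := by rw [hD1]; rfl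
      rw [hD_apply] at h1
      change (h : ℤ_[p]) * (p : ℤ_[p]) ^ Nmax * (Gf x).toAdd - ∑ j, c' j * (χ j x).toAdd = 0 at h1
      rw [sub_eq_zero, hGf_apply, ← hx, hfab] at h1
      rw [h1]
      exact Finset.sum_congr rfl fun j _ => by rw [hκ j σ x hx]
    -- in terms of `κ'`
    have hC' : ∀ σ : absoluteGaloisGroup K,
        (h : ℤ_[p]) * (p : ℤ_[p]) ^ Nmax * (f σ).toAdd =
          ∑ l, (∑ j, c' j * cc (e j) l) * (κ' l σ).toAdd := by
      intro σ
      rw [hC]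
      have h1 : ∀ j : J, (κ j σ).toAdd = ∑ l, cc (e j) l * (κ' l σ).toAdd := fun j => by
        rw [← hcc (e j) σ]
        change _ = (κ (e.symm (e j)) σ).toAdd
        rw [Equiv.symm_apply_apply]
      simp_rw [h1, Finset.mul_sum]
      rw [Finset.sum_comm]
      refine Finset.sum_congr rfl fun l _ => ?_
      rw [Finset.sum_mul]
      exact Finset.sum_congr rfl fun j _ => by ring
    -- (v) integrality via joint surjectivity of `κ'`
    set C : ℤ_[p] := (h : ℤ_[p]) * (p : ℤ_[p]) ^ Nmax with hC_def
    have hC0 : C ≠ 0 := mul_ne_zero hhp (pow_ne_zero _ (by exact_mod_cast hp.ne_zero))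
    choose σb hσb using fun l : Fin d => hκ'surj (fun l' => if l' = l then 1 else 0)
    refine ⟨fun l => (f (σb l)).toAdd, fun σ => ?_⟩
    apply mul_left_cancel₀ hC0
    rw [hC' σ, Finset.mul_sum]
    refine Finset.sum_congr rfl fun l _ => ?_
    -- the coefficient of `κ'_l` is `C · f(σ_l)`
    have h1 := hC' (σb l)
    have h2 : ∀ l', (κ' l' (σb l)).toAdd = if l' = l then 1 else 0 := fun l' => congrFun (hσb l) l'
    simp_rw [h2] at h1
    rw [Finset.sum_eq_single l (fun l' _ hl' => by rw [if_neg hl', mul_zero])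
      (fun h' => absurd (Finset.mem_univ l) h'), if_pos rfl, mul_one] at h1
    rw [← h1]; ring
  /- Step 6: assemble, reindexing `Fin d ≃ Fin (r₂ + 1)`. -/
  let ι : Fin (nrComplexPlaces K + 1) ≃ Fin d := finCongr hd.symm
  refine ⟨fun i => κ' (ι i), fun y => ?_, fun f => ?_⟩
  · obtain ⟨σ, hσ⟩ := hκ'surj (y ∘ ι.symm)
    refine ⟨σ, funext fun i => ?_⟩
    have := congrFun hσ (ι i)
    simp only [Function.comp_apply, Equiv.symm_apply_apply] at this
    exact this
  · obtain ⟨b, hb⟩ := hspan f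
    refine ⟨b ∘ ι, fun σ => ?_⟩
    rw [hb σ]
    exact (Equiv.sum_comp ι (fun l => b l * (κ' l σ).toAdd)).symm

/-- **The anticyclotomic `ℤ_p`-extension exists, given the global reciprocity law for `ℚ` and for
`K`** (no Kronecker–Weber input): both `ℤ_p`-rank facts consumed by
`exists_isAnticyclotomic_of_zpRank_facts` (`ZpExtensionAnticyclotomicProofs`) — for `ℚ`
(`Hom_cont(Γ_ℚ, ℤ_p) = ℤ_p κ_cyc`) and for the imaginary quadratic `K` (`Gal(K̃/K) ≃ ℤ_p²`) — are
instances of `zpRank_eq_nrComplexPlaces_add_one_of_globalReciprocity` (unit rank `0`).  So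
`Literature.NumberTheory.EllipticCurves.ZpExtension.exists_isAnticyclotomic` is reduced to the single classical named fact
`Literature.NumberTheory.GaloisRepresentations.exists_isGlobalReciprocityMap` (for `ℚ` and for `K`).
Ref: Greenberg (1987), §2 ("existence … can be proven by class field theory"); Washington,
*Introduction to Cyclotomic Fields*, §13.1, Thm. 13.4. [cite: Greenberg1987, §2] -/
theorem exists_isAnticyclotomic_of_globalReciprocity (hℚ : GaloisRepresentations.exists_isGlobalReciprocityMap ℚ)
    (hGR : GaloisRepresentations.exists_isGlobalReciprocityMap K) : exists_isAnticyclotomic (K := K) (p := p) := by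
  intro _ hK himag
  exact exists_isAnticyclotomic_of_zpRank_facts
    (zpRank_eq_nrComplexPlaces_add_one_of_globalReciprocity hℚ)
    (zpRank_eq_nrComplexPlaces_add_one_of_globalReciprocity hGR) hK himag

end ZpExtension

end Literature.NumberTheory.EllipticCurves
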